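import Mathlib
import HarnessLib

/-!
# A two-weight Lyapunov inequality for dissipative energy identities (absolutely continuous class)

Analysis/ODE support file (everything proved; no definitions, no named facts).  The scalar skeleton of the
"two-weight" energy argument for advection–diffusion: an energy `N` with identity `N(t) = N₀ − 2∫₀ᵗ q` (total
dissipation density `q ≥ 0`), a weighted low-mode energy `S` with identity `S(t) = S₀ − 2∫₀ᵗ D + 2∫₀ᵗ Fl`
(weighted dissipation `D`, transport flux `Fl`), and a dissipation-weighted energy `G` (think `G = Σ_k r_k|û_k|²`)
such that, almost everywhere on `[0, τ]`,
* (corridor) `N − S ≤ (4/5)(τ/log 2)·G` (the weight deviates from `1` by at most `(4/5) r_k τ/log 2` per mode),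
* (coercivity) `a·G ≤ 2a·q + 2(1−a)·D` for every `a ∈ [½, 1]`,
* (flux) `|Fl| ≤ G/10`,
satisfy, with the growing weight `A(t) = ½·e^{t log 2/τ}` (`A(0) = ½`, `A(τ) = 1`, `A′ = (log 2/τ)A`),

  `A(t)·N(t) + (1 − A(t))·S(t) ≤ ½ (N₀ + S₀)` for all `t ∈ [0, τ]`

(`twoWeight_lyapunov_le`): the functional `Φ = A·N + (1−A)·S` is absolutely continuous with a.e. derivative
`A′(N − S) − 2Aq − 2(1−A)D + 2(1−A)Fl ≤ (4/5)AG − AG + G/10 ≤ 0`.  This is the Grönwall step of a hypocoercivity-free,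
ladder-free dissipation floor: at `t = τ` it reads `N(τ) ≤ ½(N₀ + S₀)`, i.e. the energy retains at most the fraction
`½(1 + ω_k)` of each initial mode (`ω` = the low-mode weight).  Everything is stated for ABSOLUTELY CONTINUOUS primitives
with ALMOST-EVERYWHERE hypotheses (Mathlib's `AbsolutelyContinuousOnInterval`, Lebesgue differentiation
`IntervalIntegrable.ae_hasDerivAt_integral`, FTC `AbsolutelyContinuousOnInterval.integral_deriv_eq_sub`), which is the
regularity a weak solution delivers (Bedrossian–Coti Zelati 2017, §2: Grönwall on an equivalent energy functional;
Temam 1984, Ch. III Lemma 1.2: the energy identity in integrated form).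

Consumer: cell `ad-ideate`, K1L_D `stmt-AnomalousDissipation-27980`, W3-E `stub_effectiveFrameEnergyL` (i) (crux memo
`Lines/onelevel-W3E-k3l-lyapunov.md`, re-plan P3a; P3b instantiates `q, D, Fl, G` on the flat passive-vector class).

## Mathlib / tree search
Mathlib: `AbsolutelyContinuousOnInterval` (`.mul`, `.add`, `.const_mul`, `integral_deriv_eq_sub`,
`IntervalIntegrable.absolutelyContinuousOnInterval_intervalIntegral`, `ContDiffOn.absolutelyContinuousOnInterval`),
`IntervalIntegrable.ae_hasDerivAt_integral`.  Tree: `Summits/…/…W7EngineSpineAC.le_of_ac_of_ae_deriv_nonpos` (Theorems side,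
not importable here; a file-local copy is used).

## References
* J. Bedrossian, M. Coti Zelati, Arch. Ration. Mech. Anal. 224 (2017), §2. [`BedrossianCotiZelati2017`]
* R. Temam, *Navier–Stokes Equations* (1984), Ch. III §1 Lemma 1.2. [`Temam1984`]
-/

noncomputable section

open Set Real MeasureTheory intervalIntegral Filter

namespace Literature.Analysis.ODE

namespace TwoWeight

/-- An absolutely continuous function on `[t₀, t₁]` whose derivative is `≤ 0` a.e. does not increase (file-local copy of the
tree's `…W7EngineSpineAC.le_of_ac_of_ae_deriv_nonpos`). [folklore] -/
private theorem le_of_ac_of_ae_deriv_nonpos' {Φ φ : ℝ → ℝ} {t₀ t₁ : ℝ} (ht : t₀ ≤ t₁)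
    (hΦ : AbsolutelyContinuousOnInterval Φ t₀ t₁)
    (hΦd : ∀ᵐ t, t ∈ uIcc t₀ t₁ → HasDerivAt Φ (φ t) t) (hφ : ∀ᵐ t, t ∈ uIcc t₀ t₁ → φ t ≤ 0) :
    Φ t₁ ≤ Φ t₀ := by
  have hFTC := hΦ.integral_deriv_eq_sub
  have hle : ∫ x in t₀..t₁, deriv Φ x ≤ 0 := by
    have hae : ∀ᵐ x ∂volume, x ∈ Icc t₀ t₁ → deriv Φ x ≤ 0 := by
      filter_upwards [hΦd, hφ] with x hx1 hx2 hx
      rw [uIcc_of_le ht] at hx1 hx2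
      rw [(hx1 hx).deriv]; exact hx2 hx
    have hneg : 0 ≤ ∫ x in t₀..t₁, -deriv Φ x := by
      apply intervalIntegral.integral_nonneg_of_ae_restrict ht
      rw [Filter.EventuallyLE, ae_restrict_iff' measurableSet_Icc]
      filter_upwards [hae] with x hx hxI
      simpa using hx hxI
    rw [intervalIntegral.integral_neg] at hneg
    linarith
  linarith

/-- The growing weight `A(t) = ½ e^{t log 2/τ}`: derivative `(log 2/τ)·A`. [folklore] -/
private theorem hasDerivAt_weightA (τ t : ℝ) :
    HasDerivAt (fun s => 1 / 2 * Real.exp (Real.log 2 * s / τ)) (Real.log 2 / τ * (1 / 2 * Real.exp (Real.log 2 * t / τ))) t := by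
  have h1 : HasDerivAt (fun s => Real.log 2 * s / τ) (Real.log 2 / τ) t := by
    have := ((hasDerivAt_id t).const_mul (Real.log 2)).div_const τ
    simpa using this
  have h2 := (h1.exp).const_mul (1 / 2 : ℝ)
  exact h2.congr_deriv (by ring)

/-- `½ ≤ A(t) ≤ 1` on `[0, τ]`. [folklore] -/
private theorem weightA_bounds {τ t : ℝ} (hτ : 0 < τ) (ht0 : 0 ≤ t) (htτ : t ≤ τ) :
    1 / 2 ≤ 1 / 2 * Real.exp (Real.log 2 * t / τ) ∧ 1 / 2 * Real.exp (Real.log 2 * t / τ) ≤ 1 := by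
  have hlog : 0 ≤ Real.log 2 := Real.log_nonneg (by norm_num)
  constructor
  · have : 1 ≤ Real.exp (Real.log 2 * t / τ) := Real.one_le_exp (div_nonneg (mul_nonneg hlog ht0) hτ.le)
    linarith
  · have h1 : Real.log 2 * t / τ ≤ Real.log 2 := by
      rw [div_le_iff₀ hτ]
      exact mul_le_mul_of_nonneg_left htτ hlog
    have h2 : Real.exp (Real.log 2 * t / τ) ≤ 2 := by
      calc Real.exp (Real.log 2 * t / τ) ≤ Real.exp (Real.log 2) := Real.exp_le_exp.2 h1
        _ = 2 := Real.exp_log (by norm_num)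
    linarith

/-- **THE TWO-WEIGHT LYAPUNOV INEQUALITY (absolutely continuous class).**  Let `τ > 0`, `N₀, S₀ ∈ ℝ`, and let `q, D, Fl, G` be
interval integrable on `[0, τ]`; put `N(t) = N₀ − 2∫₀ᵗ q`, `S(t) = S₀ − 2∫₀ᵗ D + 2∫₀ᵗ Fl`, `A(t) = ½ e^{t log 2/τ}`.  If, for a.e.
`t ∈ [0, τ]`: `0 ≤ G t`; (corridor) `N t − S t ≤ (4/5)(τ/log 2)·G t`; (coercivity) `a·G t ≤ 2a·q t + 2(1−a)·D t` for all
`a ∈ [½, 1]`; (flux) `|Fl t| ≤ G t/10` — then `A(t)·N(t) + (1 − A(t))·S(t) ≤ ½(N₀ + S₀)` for every `t ∈ [0, τ]`.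
[cite: BedrossianCotiZelati2017, §2] [cite: Temam1984, Ch. III §1 Lemma 1.2] -/
theorem twoWeight_lyapunov_le {τ N₀ S₀ : ℝ} (hτ : 0 < τ) {q D Fl G : ℝ → ℝ}
    (hq : IntervalIntegrable q volume 0 τ) (hD : IntervalIntegrable D volume 0 τ)
    (hFl : IntervalIntegrable Fl volume 0 τ)
    (hG0 : ∀ᵐ t, t ∈ uIcc 0 τ → 0 ≤ G t)
    (h1 : ∀ᵐ t, t ∈ uIcc 0 τ →
      (N₀ - 2 * ∫ s in (0:ℝ)..t, q s) - (S₀ - 2 * (∫ s in (0:ℝ)..t, D s) + 2 * ∫ s in (0:ℝ)..t, Fl s) ≤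
        4 / 5 * (τ / Real.log 2) * G t)
    (h2 : ∀ᵐ t, t ∈ uIcc 0 τ → ∀ a : ℝ, 1 / 2 ≤ a → a ≤ 1 → a * G t ≤ 2 * a * q t + 2 * (1 - a) * D t)
    (h3 : ∀ᵐ t, t ∈ uIcc 0 τ → |Fl t| ≤ 1 / 10 * G t)
    {t : ℝ} (ht0 : 0 ≤ t) (htτ : t ≤ τ) :
    1 / 2 * Real.exp (Real.log 2 * t / τ) * (N₀ - 2 * ∫ s in (0:ℝ)..t, q s) +
        (1 - 1 / 2 * Real.exp (Real.log 2 * t / τ)) * (S₀ - 2 * (∫ s in (0:ℝ)..t, D s) + 2 * ∫ s in (0:ℝ)..t, Fl s) ≤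
      1 / 2 * (N₀ + S₀) := by
  -- names
  set A : ℝ → ℝ := fun s => 1 / 2 * Real.exp (Real.log 2 * s / τ) with hA
  set Nf : ℝ → ℝ := fun s => N₀ - 2 * ∫ r in (0:ℝ)..s, q r with hNf
  set Sf : ℝ → ℝ := fun s => S₀ - 2 * (∫ r in (0:ℝ)..s, D r) + 2 * ∫ r in (0:ℝ)..s, Fl r with hSf
  set Φ : ℝ → ℝ := fun s => A s * Nf s + (1 - A s) * Sf s with hΦ
  have hlog : 0 < Real.log 2 := Real.log_pos (by norm_num)
  -- `Φ 0 = ½ (N₀ + S₀)`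
  have hΦ0 : Φ 0 = 1 / 2 * (N₀ + S₀) := by
    simp only [hΦ, hA, hNf, hSf, intervalIntegral.integral_same, mul_zero, sub_zero, add_zero, zero_div,
      Real.exp_zero, mul_one]
    ring
  -- the goal is `Φ t ≤ Φ 0`
  suffices hmain : Φ t ≤ Φ 0 by
    rw [hΦ0] at hmain
    simpa only [hΦ, hA, hNf, hSf] using hmain
  -- restrict the integrability to `[0, t]`
  have hsub : uIcc (0:ℝ) t ⊆ uIcc 0 τ := by
    rw [uIcc_of_le ht0, uIcc_of_le hτ.le]; exact Icc_subset_Icc le_rfl htτ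
  have hq' : IntervalIntegrable q volume 0 t := hq.mono_set hsub
  have hD' : IntervalIntegrable D volume 0 t := hD.mono_set hsub
  have hFl' : IntervalIntegrable Fl volume 0 t := hFl.mono_set hsub
  -- absolute continuity of the pieces on `[0, t]`
  have h0mem : (0:ℝ) ∈ uIcc (0:ℝ) t := by rw [uIcc_of_le ht0]; exact ⟨le_rfl, ht0⟩
  have hAcd : ContDiff ℝ 1 A := by
    have : ContDiff ℝ 1 (fun s : ℝ => 1 / 2 * Real.exp (Real.log 2 * s / τ)) :=
      contDiff_const.mul (((contDiff_const.mul contDiff_id).div_const τ).exp)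
    simpa [hA] using this
  have hAac : AbsolutelyContinuousOnInterval A 0 t := hAcd.contDiffOn.absolutelyContinuousOnInterval
  have h1Aac : AbsolutelyContinuousOnInterval (fun s => 1 - A s) 0 t :=
    (contDiff_const.sub hAcd).contDiffOn.absolutelyContinuousOnInterval
  have hIq : AbsolutelyContinuousOnInterval (fun s => ∫ r in (0:ℝ)..s, q r) 0 t :=
    hq'.absolutelyContinuousOnInterval_intervalIntegral h0mem
  have hID : AbsolutelyContinuousOnInterval (fun s => ∫ r in (0:ℝ)..s, D r) 0 t :=
    hD'.absolutelyContinuousOnInterval_intervalIntegral h0mem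
  have hIFl : AbsolutelyContinuousOnInterval (fun s => ∫ r in (0:ℝ)..s, Fl r) 0 t :=
    hFl'.absolutelyContinuousOnInterval_intervalIntegral h0mem
  have hconst : ∀ c : ℝ, AbsolutelyContinuousOnInterval (fun _ : ℝ => c) 0 t := fun c =>
    (contDiff_const (c := c)).contDiffOn.absolutelyContinuousOnInterval
  have hNac : AbsolutelyContinuousOnInterval Nf 0 t := by
    have h := (hconst N₀).fun_sub (hIq.const_mul 2)
    simpa [hNf] using h
  have hSac : AbsolutelyContinuousOnInterval Sf 0 t := by
    have h := ((hconst S₀).fun_sub (hID.const_mul 2)).fun_add (hIFl.const_mul 2)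
    simpa [hSf] using h
  have hΦac : AbsolutelyContinuousOnInterval Φ 0 t := by
    have h := (hAac.fun_mul hNac).fun_add (h1Aac.fun_mul hSac)
    simpa [hΦ] using h
  -- the a.e. derivative of `Φ`
  set φ : ℝ → ℝ := fun s => Real.log 2 / τ * A s * (Nf s - Sf s) - 2 * A s * q s +
    (1 - A s) * (-(2 * D s) + 2 * Fl s) with hφ
  have hAd : ∀ s, HasDerivAt A (Real.log 2 / τ * A s) s := fun s => by
    have := hasDerivAt_weightA τ s
    simpa [hA] using this
  have hΦd : ∀ᵐ s, s ∈ uIcc (0:ℝ) t → HasDerivAt Φ (φ s) s := by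
    filter_upwards [hq'.ae_hasDerivAt_integral, hD'.ae_hasDerivAt_integral, hFl'.ae_hasDerivAt_integral]
      with s hsq hsD hsFl hs
    have hq1 := hsq hs 0 h0mem
    have hD1 := hsD hs 0 h0mem
    have hFl1 := hsFl hs 0 h0mem
    have hN1 : HasDerivAt Nf (-(2 * q s)) s := by
      have := (hasDerivAt_const s N₀).sub (hq1.const_mul 2)
      rw [zero_sub] at this
      exact this
    have hS1 : HasDerivAt Sf (-(2 * D s) + 2 * Fl s) s := by
      have := ((hasDerivAt_const s S₀).sub (hD1.const_mul 2)).add (hFl1.const_mul 2)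
      rw [zero_sub] at this
      exact this
    have h1A : HasDerivAt (fun r => 1 - A r) (-(Real.log 2 / τ * A s)) s := by
      have := (hasDerivAt_const s (1:ℝ)).sub (hAd s)
      rw [zero_sub] at this
      exact this
    have hprod := ((hAd s).mul hN1).add (h1A.mul hS1)
    have e : Real.log 2 / τ * A s * Nf s + A s * -(2 * q s) + (-(Real.log 2 / τ * A s) * Sf s +
        (1 - A s) * (-(2 * D s) + 2 * Fl s)) = φ s := by
      simp only [hφ]; ring
    rw [e] at hprod
    exact hprod.congr_of_eventuallyEq (Eventually.of_forall fun r => by simp [hΦ])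
  -- the a.e. sign of the derivative
  have hφle : ∀ᵐ s, s ∈ uIcc (0:ℝ) t → φ s ≤ 0 := by
    filter_upwards [hG0, h1, h2, h3] with s hsG hs1 hs2 hs3 hs
    have hs' : s ∈ uIcc (0:ℝ) τ := hsub hs
    have hsI : 0 ≤ s ∧ s ≤ τ := by
      rw [uIcc_of_le hτ.le] at hs'; exact hs'
    obtain ⟨hAlo, hAhi⟩ := weightA_bounds hτ hsI.1 hsI.2
    have hG := hsG hs'
    have hc1 := hs1 hs'
    have hc2 := hs2 hs' (A s) (by simpa [hA] using hAlo) (by simpa [hA] using hAhi)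
    have hc3 := hs3 hs'
    have hAlo' : 1 / 2 ≤ A s := by simpa [hA] using hAlo
    have hAhi' : A s ≤ 1 := by simpa [hA] using hAhi
    have hA0 : 0 ≤ A s := by linarith
    -- `(log 2/τ)·A·(N − S) ≤ (4/5)·A·G`
    have hterm1 : Real.log 2 / τ * A s * (Nf s - Sf s) ≤ 4 / 5 * A s * G s := by
      have hk : 0 ≤ Real.log 2 / τ * A s := mul_nonneg (div_nonneg hlog.le hτ.le) hA0
      have hc1' : Nf s - Sf s ≤ 4 / 5 * (τ / Real.log 2) * G s := by simpa [hNf, hSf] using hc1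
      calc Real.log 2 / τ * A s * (Nf s - Sf s) ≤ Real.log 2 / τ * A s * (4 / 5 * (τ / Real.log 2) * G s) :=
            mul_le_mul_of_nonneg_left hc1' hk
        _ = 4 / 5 * A s * G s := by field_simp
    -- the flux term
    have hterm3 : (1 - A s) * (2 * Fl s) ≤ 1 / 10 * G s := by
      have hFl_le : Fl s ≤ 1 / 10 * G s := (le_abs_self _).trans hc3
      nlinarith
    have : φ s = Real.log 2 / τ * A s * (Nf s - Sf s) - (2 * A s * q s + 2 * (1 - A s) * D s) +
        (1 - A s) * (2 * Fl s) := by simp only [hφ]; ring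
    rw [this]
    nlinarith
  exact le_of_ac_of_ae_deriv_nonpos' ht0 hΦac hΦd hφle

end TwoWeight

end Literature.Analysis.ODE

end
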